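import Summits.NavierStokesRegularity.NavierStokesRegularity.Theorems.SoloRefuteLiuYong2026Step4
import Summits.NavierStokesRegularity.NavierStokesRegularity.Theorems.SoloSalvageLiuYong2026
import Literature.Analysis.FluidPDE.TorusClassicalLerayHopfProofs
import Literature.Analysis.FunctionSpaces.LatticeSobolev
import Mathlib.Analysis.Calculus.BumpFunction.InnerProduct
import Mathlib.Analysis.Calculus.BumpFunction.Normed
import HarnessLib

/-!
# C138 `LiuYong2026` — slot engine: locally finite single-mode bursts (refuter-6 g3, D-0090)

Infrastructure for bounded-energy witnesses against the «averaged spectrum ⇒ pointwise regularity» steps of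
the print (附录H 引理H.1 p.57 L8–L17; 命题4.3 (4.2) p.18 L6–L9), shared with the (γ) lineage.
1. **Localization** (`isClassicalNSSolutionOn_of_locally_eq`): all four fields of `Torus.IsClassicalNSSolutionOn S`
   are local in time within `S`: a triple agreeing near every `t₀ ∈ S` with SOME exact solution on `S` is one.
2. **Slots**: `u(t,x) = h_{⌊t⌋₊} ψ(t − ⌊t⌋₊) Re(c_{⌊t⌋₊} e_{K ⌊t⌋₊}(x))`, `ψ` a `ContDiffBump` at `1/2` (radii
   `1/8 < 1/4`: `ψ = 1` on `[3/8, 5/8]`, `ψ = 0` off `(1/4, 3/4)`); near every `t₀ ≥ 0` the glued field IS the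
   single slot `⌊t₀⌋₊` (`slotVel_eq_near`, dead zones `dead_of_floor_ne`), each slot being the landed
   `isClassicalNSSolutionOn_modulated_singleton`; hence `isClassical_slotVel` (pressure `0`, force `slotFrc`),
   `isData_slotVel` (`u(0) = 0`), `isGlobalLerayHopf_slotVel` — for ANY heights `h`, wave vectors `K`, `c_n ⊥ K n`.
3. **Spectrum**: if the `±K n` are pairwise distinct, every wave vector sees at most one slot:
   `∫₀ᵀ E_k(u) ≤ h_m² E_k(w_m) ∫ψ`, Cesàro spectrum `Φ ≡ 0` (`hasCesaroSpectrum_slotVel`); `ℰ(u(t)) ≤ h² ‖c‖² / 2`.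
Recurring slots (the (γ) `Step3_K41_upper` build) can reuse 1–2 verbatim; only the count in 3 changes.
WHAT THIS IS NOT: not a claim about NS regularity or blow-up; not a claim about any author beyond the typed
locator.
-/

noncomputable section

set_option linter.dupNamespace false

open MeasureTheory Filter Set Topology
open scoped ContDiff

namespace Summit.NavierStokesRegularity.NavierStokesRegularity.Theorems.LiuYong2026.Slot

open Literature.Claims.NS.LiuYong2026
open Literature.Analysis Literature.Analysis.FluidPDE Literature.Analysis.FunctionSpaces
open Literature.Analysis.FunctionSpaces.Torus


/-! ## 1. Localization -/

section Localize

variable {d : Type*} [Fintype d] [DecidableEq d] {F : Type*} [NormedAddCommGroup F]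
  [NormedSpace ℝ F] {S : Set ℝ}

omit [DecidableEq d] in
/-- Joint smoothness on `S × T^d` is local in time within `S`. -/
theorem isSmoothSpaceTimeOn_of_locally_eq {u : ℝ → UnitAddTorus d → F}
    (h : ∀ t₀ ∈ S, ∃ O ∈ 𝓝[S] t₀, ∃ U : ℝ → UnitAddTorus d → F,
      Torus.IsSmoothSpaceTimeOn S U ∧ ∀ τ ∈ O, u τ = U τ) :
    Torus.IsSmoothSpaceTimeOn S u := by
  intro z hz
  obtain ⟨O, hO, U, hU, hag⟩ := h z.1 (mem_prod.1 hz).1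
  refine (hU z hz).congr_of_eventuallyEq ?_ ?_
  · have hmem : O ×ˢ (univ : Set (EuclideanSpace ℝ d)) ∈ 𝓝[S ×ˢ univ] z := by
      rw [← Prod.mk.eta (p := z), nhdsWithin_prod_eq]
      exact Filter.prod_mem_prod hO univ_mem
    filter_upwards [hmem] with w hw
    show u w.1 (Torus.proj w.2) = U w.1 (Torus.proj w.2)
    rw [hag w.1 (mem_prod.1 hw).1]
  · show u z.1 (Torus.proj z.2) = U z.1 (Torus.proj z.2)
    rw [hag z.1 (mem_of_mem_nhdsWithin (mem_prod.1 hz).1 hO)]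

/-- Exact classical solutions are local in time: a triple `(f, u, p)` agreeing near every
`t₀ ∈ S` (within `S`) with an exact classical solution on `S` is one. -/
theorem isClassicalNSSolutionOn_of_locally_eq {ν : ℝ}
    {f u : ℝ → UnitAddTorus d → EuclideanSpace ℝ d} {p : ℝ → UnitAddTorus d → ℝ}
    (h : ∀ t₀ ∈ S, ∃ O ∈ 𝓝[S] t₀, ∃ (F U : ℝ → UnitAddTorus d → EuclideanSpace ℝ d)
      (P : ℝ → UnitAddTorus d → ℝ), Torus.IsClassicalNSSolutionOn S ν F U P ∧
        ∀ τ ∈ O, u τ = U τ ∧ f τ = F τ ∧ p τ = P τ) :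
    Torus.IsClassicalNSSolutionOn S ν f u p where
  smooth_velocity := isSmoothSpaceTimeOn_of_locally_eq fun t₀ ht₀ => by
    obtain ⟨O, hO, F, U, P, hsol, hag⟩ := h t₀ ht₀
    exact ⟨O, hO, U, hsol.smooth_velocity, fun τ hτ => (hag τ hτ).1⟩
  smooth_pressure := isSmoothSpaceTimeOn_of_locally_eq fun t₀ ht₀ => by
    obtain ⟨O, hO, F, U, P, hsol, hag⟩ := h t₀ ht₀
    exact ⟨O, hO, P, hsol.smooth_pressure, fun τ hτ => (hag τ hτ).2.2⟩
  momentum t ht x := by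
    obtain ⟨O, hO, F, U, P, hsol, hag⟩ := h t ht
    obtain ⟨hu, hf, hp⟩ := hag t (mem_of_mem_nhdsWithin ht hO)
    have hderiv : Torus.timeDerivWithin S u t x = Torus.timeDerivWithin S U t x := by
      unfold Torus.timeDerivWithin
      refine Filter.EventuallyEq.derivWithin_eq ?_ (by rw [hu])
      filter_upwards [hO] with τ hτ
      rw [(hag τ hτ).1]
    rw [hderiv, hu, hf, hp]
    exact hsol.momentum t ht x
  divFree t ht := by
    obtain ⟨O, hO, F, U, P, hsol, hag⟩ := h t ht
    rw [(hag t (mem_of_mem_nhdsWithin ht hO)).1]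
    exact hsol.divFree t ht

end Localize

/-! ## 2. The bump -/

/-- The bump of record: a `ContDiffBump` centred at `1/2` with radii `1/8 < 1/4`. -/
def bump : ContDiffBump (1 / 2 : ℝ) := ⟨1 / 8, 1 / 4, by norm_num, by norm_num⟩

/-- `ψ = bumpFn := ⇑bump`: smooth, `0 ≤ ψ ≤ 1`, `ψ = 1` on `[3/8, 5/8]`, `ψ = 0` off `(1/4, 3/4)`. -/
def bumpFn (s : ℝ) : ℝ := bump s

/-- `ψ` is smooth. -/
theorem contDiff_bumpFn : ContDiff ℝ ∞ bumpFn := bump.contDiff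

/-- `0 ≤ ψ`. -/
theorem bumpFn_nonneg (s : ℝ) : 0 ≤ bumpFn s := bump.nonneg

/-- `ψ ≤ 1`. -/
theorem bumpFn_le_one (s : ℝ) : bumpFn s ≤ 1 := bump.le_one

/-- `ψ(1/2) = 1`. -/
theorem bumpFn_half : bumpFn (1 / 2) = 1 :=
  bump.one_of_mem_closedBall (Metric.mem_closedBall_self (by norm_num [bump]))

/-- `ψ` vanishes off `(1/4, 3/4)`. -/
theorem bumpFn_eq_zero {s : ℝ} (hs : s ≤ 1 / 4 ∨ 3 / 4 ≤ s) : bumpFn s = 0 := by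
  refine bump.zero_of_le_dist ?_
  show (1 / 4 : ℝ) ≤ dist s (1 / 2)
  rw [Real.dist_eq]
  rcases hs with hs | hs
  · rw [abs_of_nonpos (by linarith)]; linarith
  · rw [abs_of_nonneg (by linarith)]; linarith

/-- `ψ` vanishes identically near every point off `[1/4, 3/4]`. -/
theorem bumpFn_eventuallyEq_zero {s : ℝ} (hs : s < 1 / 4 ∨ 3 / 4 < s) : bumpFn =ᶠ[𝓝 s] fun _ => 0 := by
  rcases hs with hs | hs
  · filter_upwards [Iio_mem_nhds hs] with r hr using bumpFn_eq_zero (Or.inl (le_of_lt hr))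
  · filter_upwards [Ioi_mem_nhds hs] with r hr using bumpFn_eq_zero (Or.inr (le_of_lt hr))

/-! ## 3. Slots -/

section Slots

variable {d : Type*} [Fintype d] [DecidableEq d]
variable (ν : ℝ) (h : ℕ → ℝ) (K : ℕ → (d → ℤ)) (c : ℕ → EuclideanSpace ℂ d)

/-- Slot amplitude `a_n(t) = h n · ψ(t − n)`, supported in `(n + 1/4, n + 3/4)`. -/
def slotAmp (n : ℕ) (t : ℝ) : ℝ := h n * bumpFn (t - n)

/-- Slot mode `Re(c_n e_{K n})`. -/
def slotMode (n : ℕ) : UnitAddTorus d → EuclideanSpace ℝ d := realTrigPoly {K n} fun _ => c n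

/-- Single-slot velocity `a_n(t) · Re(c_n e_{K n}(x))`. -/
def slotVelOne (n : ℕ) (t : ℝ) (x : UnitAddTorus d) : EuclideanSpace ℝ d :=
  slotAmp h n t • slotMode K c n x

/-- Single-slot force `(a_n′ + 4π²ν|K n|² a_n) · Re(c_n e_{K n})` (`a_n′` within `[0,∞)`, the
convention of the landed single-mode lemma). -/
def slotFrcOne (n : ℕ) (t : ℝ) (x : UnitAddTorus d) : EuclideanSpace ℝ d :=
  (derivWithin (slotAmp h n) (Ici 0) t + ν * (4 * Real.pi ^ 2 * freqNormSq (K n)) * slotAmp h n t) •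
    slotMode K c n x

/-- The glued velocity: slot `⌊t⌋₊` at time `t`. -/
def slotVel (t : ℝ) (x : UnitAddTorus d) : EuclideanSpace ℝ d := slotVelOne h K c ⌊t⌋₊ t x

/-- The glued force: slot `⌊t⌋₊` at time `t`. -/
def slotFrc (t : ℝ) (x : UnitAddTorus d) : EuclideanSpace ℝ d := slotFrcOne ν h K c ⌊t⌋₊ t x

omit [Fintype d] [DecidableEq d] in
/-- Slot amplitudes are smooth. -/
theorem contDiff_slotAmp (n : ℕ) : ContDiff ℝ ∞ (slotAmp h n) :=
  contDiff_const.mul (contDiff_bumpFn.comp (contDiff_id.sub contDiff_const))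

omit [Fintype d] [DecidableEq d] in
/-- `a_n = 0` off `(n + 1/4, n + 3/4)`. -/
theorem slotAmp_eq_zero {n : ℕ} {s : ℝ} (hs : s - n ≤ 1 / 4 ∨ 3 / 4 ≤ s - n) :
    slotAmp h n s = 0 := by
  rw [slotAmp, bumpFn_eq_zero hs, mul_zero]

omit [Fintype d] [DecidableEq d] in
/-- `a_n′ = 0` (within any set) off `[n + 1/4, n + 3/4]`. -/
theorem derivWithin_slotAmp_eq_zero {n : ℕ} {s : ℝ} (T : Set ℝ)
    (hs : s - n < 1 / 4 ∨ 3 / 4 < s - n) : derivWithin (slotAmp h n) T s = 0 := by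
  have hev : slotAmp h n =ᶠ[𝓝 s] fun _ => (0 : ℝ) := by
    have hc : Tendsto (fun r : ℝ => r - n) (𝓝 s) (𝓝 (s - n)) :=
      (continuous_id.sub continuous_const).tendsto s
    filter_upwards [hc.eventually (bumpFn_eventuallyEq_zero hs)] with r hr
    rw [slotAmp, hr, mul_zero]
  have hev' : slotAmp h n =ᶠ[𝓝[T] s] fun _ => (0 : ℝ) := hev.filter_mono nhdsWithin_le_nhds
  rw [hev'.derivWithin_eq (slotAmp_eq_zero h (hs.imp le_of_lt le_of_lt))]
  simp

omit [Fintype d] [DecidableEq d] in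
/-- Two nonnegative times within `1/8` of each other in different unit slots are both in the
dead zones of both slots. -/
theorem dead_of_floor_ne {t₀ τ : ℝ} (ht₀ : 0 ≤ t₀) (hτ : 0 ≤ τ) (hd : |τ - t₀| < 1 / 8)
    (hne : ⌊τ⌋₊ ≠ ⌊t₀⌋₊) :
    (τ - ⌊τ⌋₊ < 1 / 4 ∨ 3 / 4 < τ - ⌊τ⌋₊) ∧ (τ - ⌊t₀⌋₊ < 1 / 4 ∨ 3 / 4 < τ - ⌊t₀⌋₊) := by
  have h1 : (⌊τ⌋₊ : ℝ) ≤ τ := Nat.floor_le hτ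
  have h2 : τ < ⌊τ⌋₊ + 1 := Nat.lt_floor_add_one τ
  have h3 : (⌊t₀⌋₊ : ℝ) ≤ t₀ := Nat.floor_le ht₀
  have h4 : t₀ < ⌊t₀⌋₊ + 1 := Nat.lt_floor_add_one t₀
  have hd' := abs_lt.1 hd
  rcases lt_or_gt_of_ne hne with hlt | hlt
  · have hle : (⌊τ⌋₊ : ℝ) + 1 ≤ ⌊t₀⌋₊ := by exact_mod_cast hlt
    exact ⟨Or.inr (by linarith), Or.inl (by linarith)⟩
  · have hle : (⌊t₀⌋₊ : ℝ) + 1 ≤ ⌊τ⌋₊ := by exact_mod_cast hlt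
    exact ⟨Or.inl (by linarith), Or.inr (by linarith)⟩

omit [DecidableEq d] in
/-- Near every `t₀ ≥ 0` the glued velocity IS the single slot `⌊t₀⌋₊`. -/
theorem slotVel_eq_near {t₀ τ : ℝ} (ht₀ : 0 ≤ t₀) (hτ : 0 ≤ τ) (hd : |τ - t₀| < 1 / 8) :
    slotVel h K c τ = slotVelOne h K c ⌊t₀⌋₊ τ := by
  by_cases hmn : ⌊τ⌋₊ = ⌊t₀⌋₊
  · funext x; rw [slotVel, hmn]
  · obtain ⟨hA, hB⟩ := dead_of_floor_ne ht₀ hτ hd hmn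
    funext x
    rw [slotVel, slotVelOne, slotVelOne, slotAmp_eq_zero h (hA.imp le_of_lt le_of_lt),
      slotAmp_eq_zero h (hB.imp le_of_lt le_of_lt), zero_smul, zero_smul]

omit [DecidableEq d] in
/-- Near every `t₀ ≥ 0` the glued force IS the single-slot force `⌊t₀⌋₊`. -/
theorem slotFrc_eq_near {t₀ τ : ℝ} (ht₀ : 0 ≤ t₀) (hτ : 0 ≤ τ) (hd : |τ - t₀| < 1 / 8) :
    slotFrc ν h K c τ = slotFrcOne ν h K c ⌊t₀⌋₊ τ := by
  by_cases hmn : ⌊τ⌋₊ = ⌊t₀⌋₊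
  · funext x; rw [slotFrc, hmn]
  · obtain ⟨hA, hB⟩ := dead_of_floor_ne ht₀ hτ hd hmn
    funext x
    rw [slotFrc, slotFrcOne, slotFrcOne, slotAmp_eq_zero h (hA.imp le_of_lt le_of_lt),
      slotAmp_eq_zero h (hB.imp le_of_lt le_of_lt), derivWithin_slotAmp_eq_zero h _ hA,
      derivWithin_slotAmp_eq_zero h _ hB]
    simp

/-- Each single slot is an exact classical solution on `[0,∞)` (landed single-mode lemma). -/
theorem isClassical_slotVelOne (hK : ∀ n, ∑ j, ((K n j : ℂ)) * c n j = 0) (n : ℕ) :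
    Torus.IsClassicalNSSolutionOn (Ici 0) ν (slotFrcOne ν h K c n) (slotVelOne h K c n)
      (fun _ _ => 0) :=
  isClassicalNSSolutionOn_modulated_singleton ν (c := fun _ => c n) (hK n)
    (contDiff_slotAmp h n).contDiffOn

/-- **The glued slot field is an exact classical solution on `[0,∞)`** (pressure `0`). -/
theorem isClassical_slotVel (hK : ∀ n, ∑ j, ((K n j : ℂ)) * c n j = 0) :
    Torus.IsClassicalNSSolutionOn (Ici 0) ν (slotFrc ν h K c) (slotVel h K c) (fun _ _ => 0) := by
  refine isClassicalNSSolutionOn_of_locally_eq fun t₀ ht₀ => ?_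
  have hO : Ioo (t₀ - 1 / 8) (t₀ + 1 / 8) ∈ 𝓝 t₀ :=
    Ioo_mem_nhds (by linarith : t₀ - 1 / 8 < t₀) (by linarith : t₀ < t₀ + 1 / 8)
  refine ⟨Ici 0 ∩ Ioo (t₀ - 1 / 8) (t₀ + 1 / 8), inter_mem_nhdsWithin _ hO,
    slotFrcOne ν h K c ⌊t₀⌋₊, slotVelOne h K c ⌊t₀⌋₊,
    fun _ _ => 0, isClassical_slotVelOne ν h K c hK ⌊t₀⌋₊, fun τ hτ => ?_⟩
  have hd : |τ - t₀| < 1 / 8 := abs_lt.2 ⟨by linarith [hτ.2.1], by linarith [hτ.2.2]⟩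
  exact ⟨slotVel_eq_near h K c ht₀ hτ.1 hd, slotFrc_eq_near ν h K c ht₀ hτ.1 hd, rfl⟩

omit [DecidableEq d] in
/-- The glued force is jointly smooth on `[0,∞) × T^d`. -/
theorem isSmoothSpaceTimeOn_slotFrc :
    Torus.IsSmoothSpaceTimeOn (Ici 0) (slotFrc ν h K c) := by
  refine isSmoothSpaceTimeOn_of_locally_eq fun t₀ ht₀ => ?_
  have hO : Ioo (t₀ - 1 / 8) (t₀ + 1 / 8) ∈ 𝓝 t₀ :=
    Ioo_mem_nhds (by linarith : t₀ - 1 / 8 < t₀) (by linarith : t₀ < t₀ + 1 / 8)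
  refine ⟨Ici 0 ∩ Ioo (t₀ - 1 / 8) (t₀ + 1 / 8), inter_mem_nhdsWithin _ hO,
    slotFrcOne ν h K c ⌊t₀⌋₊, ?_, fun τ hτ => ?_⟩
  · have ha : ContDiffOn ℝ ∞ (slotAmp h ⌊t₀⌋₊) (Ici 0) := (contDiff_slotAmp h ⌊t₀⌋₊).contDiffOn
    have hθ : ContDiffOn ℝ ∞ (fun t => derivWithin (slotAmp h ⌊t₀⌋₊) (Ici 0) t +
        ν * (4 * Real.pi ^ 2 * freqNormSq (K ⌊t₀⌋₊)) * slotAmp h ⌊t₀⌋₊ t) (Ici 0) :=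
      (((contDiffOn_infty_iff_derivWithin (uniqueDiffOn_Ici 0)).1 ha).2).add
        (contDiffOn_const.mul ha)
    exact (isSmoothSpaceTimeOn_of_time hθ).smul
      (isSmoothSpaceTimeOn_const (isSmooth_realTrigPoly {K ⌊t₀⌋₊} fun _ => c ⌊t₀⌋₊) _)
  · have hd : |τ - t₀| < 1 / 8 := abs_lt.2 ⟨by linarith [hτ.2.1], by linarith [hτ.2.2]⟩
    exact slotFrc_eq_near ν h K c ht₀ hτ.1 hd

/-- The glued force is divergence free at all times. -/
theorem isDivFree_slotFrc (hK : ∀ n, ∑ j, ((K n j : ℂ)) * c n j = 0) (t : ℝ) :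
    Torus.IsDivFree (slotFrc ν h K c t) :=
  Torus.isDivFree_const_smul
    ((isSmooth_realTrigPoly {K ⌊t⌋₊} fun _ => c ⌊t⌋₊).isContDiff (by simp))
    (isDivFree_realTrigPoly_singleton (c := fun _ => c ⌊t⌋₊) (hK ⌊t⌋₊)) _

omit [DecidableEq d] in
/-- The glued velocity vanishes at `t = 0` (`ψ(0) = 0`). -/
theorem slotVel_zero : slotVel h K c 0 = fun _ => 0 := by
  funext x
  rw [slotVel, slotVelOne, slotAmp_eq_zero h (Or.inl (by simp))]
  exact zero_smul _ _

end Slots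

/-! ## 4. Data and Leray–Hopf on `T³` -/

section Three

variable (ν : ℝ) (h : ℕ → ℝ) (K : ℕ → Z3) (c : ℕ → C3)

/-- The glued slot field with its force is admissible data for `ν > 0`. -/
theorem isData_slotVel (hν : 0 < ν) (hK : ∀ n, ∑ j, ((K n j : ℂ)) * c n j = 0) :
    IsData ν (slotFrc ν h K c) (slotVel h K c 0) where
  visc := hν
  force_smooth := isSmoothSpaceTimeOn_slotFrc ν h K c
  force_divFree t _ := isDivFree_slotFrc ν h K c hK t
  datum_smooth := by rw [slotVel_zero]; exact isSmooth_const _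
  datum_divFree := by rw [slotVel_zero]; exact (isClassicalNSSolutionOn_const (d := Fin 3) ν 0).divFree 0 (mem_univ _)

/-- The glued slot field is a global Leray–Hopf solution from its (zero) datum. -/
theorem isGlobalLerayHopf_slotVel (hK : ∀ n, ∑ j, ((K n j : ℂ)) * c n j = 0) :
    Torus.IsGlobalLerayHopf ν (slotFrc ν h K c) (slotVel h K c 0) (slotVel h K c) :=
  fun _T hT => (isClassical_slotVel ν h K c hK).isLerayHopfOn_of_convex (convex_Ici 0) hT
    Icc_subset_Ici_self

/-! ### Mode energies: each wave vector sees at most one slot ⇒ Cesàro spectrum `Φ ≡ 0` -/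

/-- A slot mode has energy only at `±K n`. -/
theorem modeEnergy_slotMode_eq_zero {n : ℕ} {k : Z3} (h1 : k ≠ K n) (h2 : k ≠ -K n) :
    modeEnergy (slotMode K c n) k = 0 := by
  unfold modeEnergy coeff slotMode
  rw [mFourierCoeff_realTrigPoly_singleton, if_neg h1, if_neg h2, EuclideanSpace.conjVec_zero,
    add_zero, smul_zero, norm_zero]
  simp

/-- Mode energies of the glued field: slot `⌊t⌋₊` only. -/
theorem modeEnergy_slotVel (t : ℝ) (k : Z3) :
    modeEnergy (slotVel h K c t) k = slotAmp h ⌊t⌋₊ t ^ 2 * modeEnergy (slotMode K c ⌊t⌋₊) k :=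
  Spike.modeEnergy_smul _ _ _

/-- If the wave vectors `±K n` are pairwise distinct across slots, a wave vector `k = ±K m` sees
only slot `m`: `E_k(u(t)) ≤ h_m² E_k(w_m) ψ(t − m)` for `t ≥ 0`. -/
theorem modeEnergy_slotVel_le (hK : ∀ n m, (K n = K m ∨ K n = -K m) → n = m) {m : ℕ} {k : Z3}
    (hm : k = K m ∨ k = -K m) (t : ℝ) :
    modeEnergy (slotVel h K c t) k ≤ h m ^ 2 * modeEnergy (slotMode K c m) k * bumpFn (t - m) := by
  rw [modeEnergy_slotVel]
  by_cases hfl : ⌊t⌋₊ = m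
  · rw [hfl, slotAmp, mul_pow]
    have hψ : bumpFn (t - m) ^ 2 ≤ bumpFn (t - m) := by
      nlinarith [bumpFn_nonneg (t - m), bumpFn_le_one (t - m)]
    nlinarith [LiuYong2026Salvage.modeEnergy_nonneg (slotMode K c m) k, sq_nonneg (h m),
      mul_nonneg (mul_nonneg (sq_nonneg (h m)) (LiuYong2026Salvage.modeEnergy_nonneg (slotMode K c m) k))
        (sub_nonneg.2 hψ)]
  · have h0 : modeEnergy (slotMode K c ⌊t⌋₊) k = 0 := by
      refine modeEnergy_slotMode_eq_zero K c (fun hk1 => hfl (hK _ _ ?_)) (fun hk2 => hfl (hK _ _ ?_))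
      · rw [← hk1]; exact hm
      · have e : K ⌊t⌋₊ = -k := by rw [hk2, neg_neg]
        rcases hm with hm | hm
        · exact Or.inr (by rw [e, hm])
        · exact Or.inl (by rw [e, hm, neg_neg])
    rw [h0, mul_zero]
    exact mul_nonneg (mul_nonneg (sq_nonneg _) (LiuYong2026Salvage.modeEnergy_nonneg _ _)) (bumpFn_nonneg _)

/-- `∫₀ᵀ ψ(t − m) dt ≤ ∫_ℝ ψ`. -/
theorem integral_bumpFn_shift_le (m : ℕ) {T : ℝ} (hT : 0 ≤ T) :
    ∫ t in (0 : ℝ)..T, bumpFn (t - m) ≤ ∫ s, bumpFn s := by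
  rw [intervalIntegral.integral_comp_sub_right (fun s => bumpFn s) (m : ℝ),
    intervalIntegral.integral_of_le (by linarith)]
  exact setIntegral_le_integral bump.integrable (Eventually.of_forall fun s => bumpFn_nonneg s)

/-- Uniform bound on the windowed mode energy: `∫₀ᵀ E_k(u) ≤ h_m² E_k(w_m) ∫ψ`. -/
theorem integral_modeEnergy_slotVel_le (hK : ∀ n m, (K n = K m ∨ K n = -K m) → n = m) {m : ℕ}
    {k : Z3} (hm : k = K m ∨ k = -K m) {T : ℝ} (hT : 0 ≤ T) :
    ∫ t in (0 : ℝ)..T, modeEnergy (slotVel h K c t) k ≤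
      h m ^ 2 * modeEnergy (slotMode K c m) k * ∫ s, bumpFn s := by
  have hM : 0 ≤ h m ^ 2 * modeEnergy (slotMode K c m) k :=
    mul_nonneg (sq_nonneg _) (LiuYong2026Salvage.modeEnergy_nonneg _ _)
  have hI : 0 ≤ ∫ s, bumpFn s := integral_nonneg bumpFn_nonneg
  by_cases hint : IntervalIntegrable (fun t => modeEnergy (slotVel h K c t) k) volume 0 T
  · have hg : IntervalIntegrable (fun t => h m ^ 2 * modeEnergy (slotMode K c m) k * bumpFn (t - m))
        volume 0 T :=
      ((contDiff_bumpFn.continuous.comp (continuous_id.sub continuous_const)).const_mul _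
        ).intervalIntegrable _ _
    calc ∫ t in (0 : ℝ)..T, modeEnergy (slotVel h K c t) k
        ≤ ∫ t in (0 : ℝ)..T, h m ^ 2 * modeEnergy (slotMode K c m) k * bumpFn (t - m) :=
          intervalIntegral.integral_mono_on hT hint hg fun t _ =>
            modeEnergy_slotVel_le h K c hK hm t
      _ = h m ^ 2 * modeEnergy (slotMode K c m) k * ∫ t in (0 : ℝ)..T, bumpFn (t - m) :=
          intervalIntegral.integral_const_mul _ _
      _ ≤ h m ^ 2 * modeEnergy (slotMode K c m) k * ∫ s, bumpFn s :=
          mul_le_mul_of_nonneg_left (integral_bumpFn_shift_le m hT) hM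
  · rw [intervalIntegral.integral_undef hint]
    exact mul_nonneg hM hI

/-- **Cesàro spectrum `Φ ≡ 0`** for slot fields whose wave vectors `±K n` are pairwise distinct. -/
theorem hasCesaroSpectrum_slotVel (hK : ∀ n m, (K n = K m ∨ K n = -K m) → n = m) :
    HasCesaroSpectrum (slotVel h K c) (fun _ => 0) := by
  intro k _
  by_cases hk : ∃ m, k = K m ∨ k = -K m
  · obtain ⟨m, hm⟩ := hk
    set M : ℝ := h m ^ 2 * modeEnergy (slotMode K c m) k * ∫ s, bumpFn s
    have hup : Tendsto (fun T : ℝ => M * T⁻¹) atTop (𝓝 0) := by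
      simpa using tendsto_inv_atTop_zero.const_mul M
    refine tendsto_of_tendsto_of_tendsto_of_le_of_le' tendsto_const_nhds hup ?_ ?_
    · filter_upwards [eventually_gt_atTop (0 : ℝ)] with T hT
      exact mul_nonneg (inv_nonneg.mpr hT.le)
        (intervalIntegral.integral_nonneg hT.le fun t _ => LiuYong2026Salvage.modeEnergy_nonneg _ _)
    · filter_upwards [eventually_gt_atTop (0 : ℝ)] with T hT
      rw [mul_comm]
      exact mul_le_mul_of_nonneg_right (integral_modeEnergy_slotVel_le h K c hK hm hT.le)
        (inv_nonneg.mpr hT.le)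
  · push Not at hk
    have h0 : ∀ t, modeEnergy (slotVel h K c t) k = 0 := fun t => by
      rw [modeEnergy_slotVel, modeEnergy_slotMode_eq_zero K c (hk _).1 (hk _).2, mul_zero]
    simp only [h0, intervalIntegral.integral_zero, mul_zero]
    exact tendsto_const_nhds

end Three

end Summit.NavierStokesRegularity.NavierStokesRegularity.Theorems.LiuYong2026.Slot
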